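import Literature.MathematicalPhysics.QuantumLattice.HeisenbergStarIntegerSpectrum
import Literature.MathematicalPhysics.QuantumLattice.HeisenbergModelGlobalRotationProofs
import HarnessLib

/-!
# Plus-antipodal laminar Lieb–Mattis row — part A: algebra (pseudo F29; STAGED, not filed; chain A → B → C)

HONEST FRAMING: ladder R1–R4 with certified numbers; no claim on H/H₀.
Part A of the ≤ 400-line split of `lean-staged/PlusAntipodalRow.lean` (the monolith is the farm-checked
concatenation; declarations byte-identical).  Pair Casimirs `𝐋²_{x,y} = 3/2 + 2𝐒_x·𝐒_y`, their idempotency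
`(𝐋²_{x,y})² = 2𝐋²_{x,y}`, commutation of `𝐒_x·𝐒_y` with set spins, the row `plusRow` and its exchange
form `plusRow_eq`, and the quadratic-form toolkit (`qf_split` along commuting Hermitian idempotents).
Intended tree path: `Summits/HubbardSuperconductivity/HubbardLadder/HeisenbergPlusAntipodalRowAlgebra.lean`.
-/


noncomputable section

open Matrix Complex Finset
open scoped ComplexOrder Matrix.Norms.L2Operator MatrixOrder

namespace Summit.HubbardSuperconductivity.HubbardLadder.PlusAntipodal

open Literature.MathematicalPhysics.QuantumLattice SpinOperators

variable {Λ : Type*} [Fintype Λ] [DecidableEq Λ]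

/-- `𝐋²_{x,y} = 3/2 + 2 𝐒_x·𝐒_y`. -/
theorem pair_setSpinSq {x y : Λ} (hxy : x ≠ y) :
    (∑ α : Fin 3, (∑ z ∈ ({x, y} : Finset Λ), siteSpin 1 z α) *
        (∑ z ∈ ({x, y} : Finset Λ), siteSpin 1 z α) : Op Λ 2)
      = (3 / 2 : ℂ) • (1 : Op Λ 2) + (2 : ℂ) • spinDot 1 x y := by
  have hx : x ∉ ({y} : Finset Λ) := by simp [hxy]
  have h := setSpinSq_insert (Λ := Λ) hx
  have h1 : (∑ α : Fin 3, (∑ z ∈ ({y} : Finset Λ), siteSpin 1 z α) *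
        (∑ z ∈ ({y} : Finset Λ), siteSpin 1 z α) : Op Λ 2) = (3 / 4 : ℂ) • (1 : Op Λ 2) := by
    simp only [Finset.sum_singleton, siteSpin_one_mul_self, Finset.sum_const, Finset.card_univ,
      Fintype.card_fin]
    rw [← Nat.cast_smul_eq_nsmul ℂ, smul_smul]; norm_num
  rw [h, h1, Finset.sum_singleton]
  module

/-- `(𝐋²_{x,y})² = 2 𝐋²_{x,y}` (spectrum `{0, 2}`). -/
theorem pair_setSpinSq_mul_self {x y : Λ} (hxy : x ≠ y) :
    ((∑ α : Fin 3, (∑ z ∈ ({x, y} : Finset Λ), siteSpin 1 z α) *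
        (∑ z ∈ ({x, y} : Finset Λ), siteSpin 1 z α) : Op Λ 2) *
      (∑ α : Fin 3, (∑ z ∈ ({x, y} : Finset Λ), siteSpin 1 z α) *
        (∑ z ∈ ({x, y} : Finset Λ), siteSpin 1 z α) : Op Λ 2))
      = (2 : ℂ) • (∑ α : Fin 3, (∑ z ∈ ({x, y} : Finset Λ), siteSpin 1 z α) *
        (∑ z ∈ ({x, y} : Finset Λ), siteSpin 1 z α) : Op Λ 2) := by
  rw [pair_setSpinSq hxy]
  have hg := spinDot_one_mul_self (Λ := Λ) hxy
  simp only [Matrix.add_mul, Matrix.mul_add, Matrix.smul_mul, Matrix.mul_smul, Matrix.one_mul,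
    Matrix.mul_one, smul_smul, hg, smul_add, smul_sub]
  module

/-- `𝐒_x·𝐒_y` commutes with `Σ_{z∈Y} Sᵅ_z` when `x, y ∉ Y`. -/
theorem commute_spinDot_setSpin_of_not_mem {x y : Λ} (hxy : x ≠ y) {Y : Finset Λ}
    (hx : x ∉ Y) (hy : y ∉ Y) (α : Fin 3) :
    Commute (spinDot 1 x y : Op Λ 2) (∑ z ∈ Y, siteSpin 1 z α) := by
  refine Commute.sum_right _ _ _ fun z hz => ?_
  rw [spinDot_eq_sum_mul_of_ne 1 hxy]
  refine Commute.sum_left _ _ _ fun β _ => ?_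
  exact ((siteSpin_commute_of_ne_holds 1 (ne_of_mem_of_not_mem hz hx).symm β α).mul_left
    (siteSpin_commute_of_ne_holds 1 (ne_of_mem_of_not_mem hz hy).symm β α))

/-- `𝐒_x·𝐒_y` commutes with `Σ_{z∈Y} Sᵅ_z` when `x, y ∈ Y` (rotation invariance). -/
theorem commute_spinDot_setSpin_of_mem {x y : Λ} (hxy : x ≠ y) {Y : Finset Λ}
    (hx : x ∈ Y) (hy : y ∈ Y) (α : Fin 3) :
    Commute (spinDot 1 x y : Op Λ 2) (∑ z ∈ Y, siteSpin 1 z α) := by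
  have hsplit : (∑ z ∈ Y, siteSpin 1 z α : Op Λ 2) = totalSpin 1 α - ∑ z ∈ Yᶜ, siteSpin 1 z α := by
    rw [eq_sub_iff_add_eq, totalSpin, ← Finset.sum_add_sum_compl Y]
  rw [hsplit]
  refine (commute_spinDot_totalSpin 1 x y α).sub_right ?_
  exact commute_spinDot_setSpin_of_not_mem hxy (by simpa using hx) (by simpa using hy) α


/-- `𝐒_x·𝐒_y` commutes with `Sᵝ_z` for a third site `z`. -/
theorem commute_spinDot_siteSpin {x y z : Λ} (hxy : x ≠ y) (hxz : x ≠ z) (hyz : y ≠ z) (β : Fin 3) :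
    Commute (spinDot 1 x y : Op Λ 2) (siteSpin 1 z β) := by
  have h := commute_spinDot_setSpin_of_not_mem hxy (Y := {z}) (by simpa using hxz) (by simpa using hyz) β
  simpa using h

/-- `𝐒_x·𝐒_y` commutes with `𝐒_u·𝐒_v` on two further sites. -/
theorem commute_spinDot_spinDot {x y u v : Λ} (hxy : x ≠ y) (huv : u ≠ v) (hxu : x ≠ u) (hxv : x ≠ v)
    (hyu : y ≠ u) (hyv : y ≠ v) :
    Commute (spinDot 1 x y : Op Λ 2) (spinDot 1 u v) := by
  rw [spinDot_eq_sum_mul_of_ne 1 huv]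
  refine Commute.sum_right _ _ _ fun β _ => ?_
  exact (commute_spinDot_siteSpin hxy hxu hyu β).mul_right (commute_spinDot_siteSpin hxy hxv hyv β)

/-- The row operator `3𝐋²_{n,s} + 3𝐋²_{e,w} - 𝐋²_{n,s,e,w} + 4 Σ_{y∈arms} 𝐒_c·𝐒_y`. -/
def plusRow (c n s e w : Λ) : Op Λ 2 :=
  (3 : ℂ) • (∑ α : Fin 3, (∑ y ∈ ({n, s} : Finset Λ), siteSpin 1 y α) *
      (∑ y ∈ ({n, s} : Finset Λ), siteSpin 1 y α) : Op Λ 2)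
  + (3 : ℂ) • (∑ α : Fin 3, (∑ y ∈ ({e, w} : Finset Λ), siteSpin 1 y α) *
      (∑ y ∈ ({e, w} : Finset Λ), siteSpin 1 y α) : Op Λ 2)
  - (∑ α : Fin 3, (∑ y ∈ ({n, s, e, w} : Finset Λ), siteSpin 1 y α) *
      (∑ y ∈ ({n, s, e, w} : Finset Λ), siteSpin 1 y α) : Op Λ 2)
  + (4 : ℂ) • (∑ y ∈ ({n, s, e, w} : Finset Λ), spinDot 1 c y : Op Λ 2)

/-- Swapping the two pairs does not change the row. -/
theorem plusRow_swap (c n s e w : Λ) : plusRow c e w n s = plusRow c n s e w := by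
  have hset : ({e, w, n, s} : Finset Λ) = {n, s, e, w} := by
    ext z; simp only [Finset.mem_insert, Finset.mem_singleton]; tauto
  unfold plusRow
  rw [hset]
  abel

section Sites

variable {c n s e w : Λ}

/-- The row operator written out in exchange terms:
`plusRow = 6 + 4(𝐒_n·𝐒_s + 𝐒_e·𝐒_w) - 2(𝐒_n·𝐒_e + 𝐒_n·𝐒_w + 𝐒_s·𝐒_e + 𝐒_s·𝐒_w) + 4 Σ_arms 𝐒_c·𝐒_y`;
in a translation/rotation-invariant state with arms at `(0,±1), (±1,0)` and `3c(d) = ⟨𝐒_0·𝐒_d⟩` its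
expectation is `6 + 24c(0,2) - 24c(1,1) + 48c(0,1)`, i.e. the LP row `c(0,2) - c(1,1) + 2c(0,1) + ¼ ≥ 0`. -/
theorem plusRow_eq (hns : n ≠ s) (hne : n ≠ e) (hnw : n ≠ w) (hse : s ≠ e) (hsw : s ≠ w)
    (hew : e ≠ w) :
    plusRow c n s e w = (6 : ℂ) • (1 : Op Λ 2)
      + (4 : ℂ) • (spinDot 1 n s + spinDot 1 e w : Op Λ 2)
      - (2 : ℂ) • (spinDot 1 n e + spinDot 1 n w + spinDot 1 s e + spinDot 1 s w : Op Λ 2)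
      + (4 : ℂ) • (spinDot 1 c n + spinDot 1 c s + spinDot 1 c e + spinDot 1 c w : Op Λ 2) := by
  have h1 : n ∉ ({s, e, w} : Finset Λ) := by simp [hns, hne, hnw]
  have h2 : s ∉ ({e, w} : Finset Λ) := by simp [hse, hsw]
  have hT : ((∑ α : Fin 3, (∑ y ∈ ({n, s, e, w} : Finset Λ), siteSpin 1 y α) * (∑ y ∈ ({n, s, e, w} : Finset Λ), siteSpin 1 y α) : Op _ 2) : Op Λ 2) = (3 : ℂ) • (1 : Op Λ 2) + (2 : ℂ) •
      (spinDot 1 n s + spinDot 1 n e + spinDot 1 n w + spinDot 1 s e + spinDot 1 s w + spinDot 1 e w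
        : Op Λ 2) := by
    rw [setSpinSq_insert h1, setSpinSq_insert h2, pair_setSpinSq hew, Finset.sum_insert h2,
      Finset.sum_pair hew, Finset.sum_pair hew]
    module
  have hG : (∑ y ∈ ({n, s, e, w} : Finset Λ), spinDot 1 c y : Op Λ 2) =
      spinDot 1 c n + spinDot 1 c s + spinDot 1 c e + spinDot 1 c w := by
    rw [Finset.sum_insert h1, Finset.sum_insert h2, Finset.sum_pair hew]; abel
  unfold plusRow
  rw [pair_setSpinSq hns, pair_setSpinSq hew, hT, hG]
  module

/-- `Σ_{y∈{n,s,e,w}} Sᵅ_y = Σ_{y∈{n,s}} Sᵅ_y + Σ_{y∈{e,w}} Sᵅ_y`. -/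
theorem setSpin_arms (hns : n ≠ s) (hne : n ≠ e) (hnw : n ≠ w) (hse : s ≠ e) (hsw : s ≠ w)
    (α : Fin 3) :
    (∑ y ∈ ({n, s, e, w} : Finset Λ), siteSpin 1 y α : Op Λ 2) =
      (∑ y ∈ ({n, s} : Finset Λ), siteSpin 1 y α) + ∑ y ∈ ({e, w} : Finset Λ), siteSpin 1 y α := by
  have h1 : n ∉ ({s, e, w} : Finset Λ) := by simp [hns, hne, hnw]
  have h2 : s ∉ ({e, w} : Finset Λ) := by simp [hse, hsw]
  have h4 : n ∉ ({s} : Finset Λ) := by simp [hns]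
  rw [Finset.sum_insert h1, Finset.sum_insert h2, Finset.sum_insert h4, Finset.sum_singleton]
  abel

/-- The star over the arms splits: `Σ_{y∈{n,s,e,w}} 𝐒_c·𝐒_y = Σ_{ns} + Σ_{ew}`. -/
theorem star_arms (hns : n ≠ s) (hne : n ≠ e) (hnw : n ≠ w) (hse : s ≠ e) (hsw : s ≠ w) :
    (∑ y ∈ ({n, s, e, w} : Finset Λ), spinDot 1 c y : Op Λ 2) =
      (∑ y ∈ ({n, s} : Finset Λ), spinDot 1 c y) + ∑ y ∈ ({e, w} : Finset Λ), spinDot 1 c y := by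
  have h1 : n ∉ ({s, e, w} : Finset Λ) := by simp [hns, hne, hnw]
  have h2 : s ∉ ({e, w} : Finset Λ) := by simp [hse, hsw]
  have h4 : n ∉ ({s} : Finset Λ) := by simp [hns]
  rw [Finset.sum_insert h1, Finset.sum_insert h2, Finset.sum_insert h4, Finset.sum_singleton]
  abel

/-- `𝐒_n·𝐒_s` commutes with the row operator. -/
theorem commute_pair_plusRow (hcn : c ≠ n) (hcs : c ≠ s) (hce : c ≠ e) (hcw : c ≠ w)
    (hns : n ≠ s) (hne : n ≠ e) (hnw : n ≠ w) (hse : s ≠ e) (hsw : s ≠ w) :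
    Commute (spinDot 1 n s : Op Λ 2) (plusRow c n s e w) := by
  have hcA : c ∉ ({n, s, e, w} : Finset Λ) := by simp [hcn, hcs, hce, hcw]
  -- with each set-spin component
  have hN : ∀ α, Commute (spinDot 1 n s : Op Λ 2) (∑ y ∈ ({n, s} : Finset Λ), siteSpin 1 y α) :=
    fun α => commute_spinDot_setSpin_of_mem hns (by simp) (by simp) α
  have hE : ∀ α, Commute (spinDot 1 n s : Op Λ 2) (∑ y ∈ ({e, w} : Finset Λ), siteSpin 1 y α) :=
    fun α => commute_spinDot_setSpin_of_not_mem hns (by simp [hne, hnw]) (by simp [hse, hsw]) α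
  have hA : ∀ α, Commute (spinDot 1 n s : Op Λ 2) (∑ y ∈ ({n, s, e, w} : Finset Λ), siteSpin 1 y α) :=
    fun α => commute_spinDot_setSpin_of_mem hns (by simp) (by simp) α
  have hC : ∀ α, Commute (spinDot 1 n s : Op Λ 2) (siteSpin 1 c α) :=
    fun α => commute_spinDot_siteSpin hns hcn.symm hcs.symm α
  have hG : Commute (spinDot 1 n s : Op Λ 2) (∑ y ∈ ({n, s, e, w} : Finset Λ), spinDot 1 c y) := by
    rw [heisStar_eq_sum 1 hcA]
    exact Commute.sum_right _ _ _ fun α _ => (hC α).mul_right (hA α)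
  unfold plusRow
  refine ((((Commute.sum_right _ _ _ fun α _ => (hN α).mul_right (hN α)).smul_right _).add_right
    ((Commute.sum_right _ _ _ fun α _ => (hE α).mul_right (hE α)).smul_right _)).sub_right
    (Commute.sum_right _ _ _ fun α _ => (hA α).mul_right (hA α))).add_right (hG.smul_right _)

end Sites


/-! ### Quadratic-form bookkeeping -/

section QF

variable {m : Type*} [Fintype m]

/-- `⟨Xψ, O Y ψ⟩ = ⟨ψ, Xᴴ O Y ψ⟩`. -/
theorem qf_conj (X O Y : Matrix m m ℂ) (ψ : m → ℂ) :
    star (X *ᵥ ψ) ⬝ᵥ (O *ᵥ (Y *ᵥ ψ)) = star ψ ⬝ᵥ ((Xᴴ * O * Y) *ᵥ ψ) := by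
  simp only [Matrix.star_mulVec, Matrix.mulVec_mulVec, Matrix.dotProduct_mulVec,
    Matrix.vecMul_vecMul, Matrix.mul_assoc]

/-- Splitting a quadratic form along a Hermitian idempotent `P` commuting with `O`:
`⟨ψ,Oψ⟩ = ⟨Pψ, O Pψ⟩ + ⟨(1-P)ψ, O (1-P)ψ⟩`. -/
theorem qf_split [DecidableEq m] (O P : Matrix m m ℂ) (hP : Pᴴ = P) (hPP : P * P = P)
    (hc : P * O = O * P) (ψ : m → ℂ) :
    star ψ ⬝ᵥ (O *ᵥ ψ) = star (P *ᵥ ψ) ⬝ᵥ (O *ᵥ (P *ᵥ ψ)) +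
      star ((1 - P) *ᵥ ψ) ⬝ᵥ (O *ᵥ ((1 - P) *ᵥ ψ)) := by
  rw [qf_conj, qf_conj, ← dotProduct_add, ← Matrix.add_mulVec]
  have h1 : P * O * P = O * P := by rw [hc, Matrix.mul_assoc, hPP]
  have h2 : (1 - P)ᴴ * O * (1 - P) = O - O * P := by
    rw [conjTranspose_sub, conjTranspose_one, hP]
    simp only [Matrix.sub_mul, Matrix.mul_sub, Matrix.one_mul, Matrix.mul_one]
    rw [h1, hc]; abel
  rw [hP, h1, h2, add_sub_cancel]

/-- `⟨φ, A A φ⟩ = ⟨Aφ, Aφ⟩` for Hermitian `A`. -/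
theorem qf_sq (A : Matrix m m ℂ) (hA : A.IsHermitian) (φ : m → ℂ) :
    star φ ⬝ᵥ ((A * A) *ᵥ φ) = star (A *ᵥ φ) ⬝ᵥ (A *ᵥ φ) := by
  rw [← Matrix.mulVec_mulVec, Matrix.dotProduct_mulVec, Matrix.star_mulVec, hA.eq]

/-- If two Hermitian operators agree on `φ`, their squares have the same expectation in `φ`. -/
theorem qf_sq_eq {A B : Matrix m m ℂ} (hA : A.IsHermitian) (hB : B.IsHermitian) {φ : m → ℂ}
    (h : A *ᵥ φ = B *ᵥ φ) :
    star φ ⬝ᵥ ((A * A) *ᵥ φ) = star φ ⬝ᵥ ((B * B) *ᵥ φ) := by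
  rw [qf_sq A hA, qf_sq B hB, h]

/-- `⟨φ, (κ•1 - T) φ⟩ = κ ⟨φ,φ⟩ - ⟨φ, Tφ⟩` and friends are handled by this simp set. -/
theorem qf_smul [DecidableEq m] (κ : ℂ) (φ : m → ℂ) :
    star φ ⬝ᵥ ((κ • (1 : Matrix m m ℂ)) *ᵥ φ) = κ * (star φ ⬝ᵥ φ) := by
  rw [Matrix.smul_mulVec, Matrix.one_mulVec, dotProduct_smul, smul_eq_mul]

end QF

/-- `Σ_{y∈Y} Sᵅ_y` is Hermitian. -/
theorem setSpin_isHermitian' (Y : Finset Λ) (α : Fin 3) :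
    (∑ y ∈ Y, siteSpin 1 y α : Op Λ 2).IsHermitian := by
  rw [IsHermitian, conjTranspose_sum]
  exact Finset.sum_congr rfl fun y _ => (siteSpin_isHermitian 1 y α).eq

/-- `⟨φ, (Σ_y Sᵅ_y)² φ⟩ = ‖(Σ_y Sᵅ_y) φ‖²`. -/
theorem qf_setSpinSq (Y : Finset Λ) (β : Fin 3) (φ : TensorIndex Λ 2 → ℂ) :
    star φ ⬝ᵥ (((∑ y ∈ Y, siteSpin 1 y β) * (∑ y ∈ Y, siteSpin 1 y β) : Op Λ 2) *ᵥ φ) =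
      star ((∑ y ∈ Y, siteSpin 1 y β : Op Λ 2) *ᵥ φ) ⬝ᵥ ((∑ y ∈ Y, siteSpin 1 y β : Op Λ 2) *ᵥ φ) :=
  qf_sq _ (setSpin_isHermitian' Y β) φ

/-- `𝐋_Y²` is Hermitian. -/
theorem setSpinSq_isHermitian (Y : Finset Λ) : ((∑ α : Fin 3, (∑ y ∈ Y, siteSpin 1 y α) * (∑ y ∈ Y, siteSpin 1 y α) : Op _ 2) : Op Λ 2).IsHermitian :=
  (posSemidef_setSpinSq Y).isHermitian

/-- If `𝐋_Y² φ = 0` then every component `(Σ_{y∈Y} Sᵅ_y) φ = 0`. -/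
theorem setSpin_mulVec_eq_zero {Y : Finset Λ} {φ : TensorIndex Λ 2 → ℂ}
    (h : ((∑ α : Fin 3, (∑ y ∈ Y, siteSpin 1 y α) * (∑ y ∈ Y, siteSpin 1 y α) : Op _ 2) : Op Λ 2) *ᵥ φ = 0) (α : Fin 3) :
    (∑ y ∈ Y, siteSpin 1 y α : Op Λ 2) *ᵥ φ = 0 := by
  have hq : ∑ β : Fin 3, star ((∑ y ∈ Y, siteSpin 1 y β : Op Λ 2) *ᵥ φ) ⬝ᵥ
      ((∑ y ∈ Y, siteSpin 1 y β : Op Λ 2) *ᵥ φ) = 0 := by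
    have := congrArg (fun v => star φ ⬝ᵥ v) h
    simpa only [Matrix.sum_mulVec, dotProduct_sum, dotProduct_zero, qf_setSpinSq] using this
  rw [Finset.sum_eq_zero_iff_of_nonneg (fun β _ => dotProduct_star_self_nonneg _)] at hq
  exact dotProduct_star_self_eq_zero.mp (hq α (Finset.mem_univ α))

end Summit.HubbardSuperconductivity.HubbardLadder.PlusAntipodal
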